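import Summits.QuantumFields.YangMills.Theorems.BalabanUVNodesK2OwnDriftPair

/-!
# Crux K2⁷ `EndpointGivenBR13SepCoPH` (stmt-QuantumFields-20543), v7 CORNER edition (REGISTERED skeleton 795c9e8285fed415 on 20543, now `aside` at route rev 27; draft 39189bf31904f7f3) — THE (D4) SOCKET AT AN ANCHORED CORNER SEQUENCE `b`:
# the `b`-PARAMETRIC leaf socket serves 1ᶜᴿ's body as is; the split-keyed socket of record `ChainTFac190H … Sβ …` serves it MODULO THE COINCIDENCE «fill = corner»
# (an4 (K)∕(K′), DEF-1 g6 (ii), dag-n18-w1 «fill = corner is a coincidence condition»; hypothesis form; 0 `def`, 0 `sorry`)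

Cell pub-balaban (b2b), seat `b2b-balaban-beta-an4` (BINDER row D4 OWNER; (D4) socket desk), gen 153.  Helper for crux K2⁷ = stmt-QuantumFields-20543 (`--supports … --as helper`);
count-neutral; NO skeleton is registered or re-keyed by this file.

THE POINT (pub-ymgap I.30587 (K), I.30845 (K′), I.30702 (ii)).  The row-(D4) socket of record `ChainTFac190H 4 M μ ν Sβ γ₀ c ℓ α₂ q` is typed over a one-loop split
`Sβ : OneLoopSplit D.βfun`, and EVERY split has `Sβ.β0 = fun k => D.βfun k 0⃗` — the FILL, the off-box convention value of the datum's β (`split_β0_eq_zeroHistoryValues`, p609486 §0;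
at the records of record `v₀ := 0⃗` it is `beta0OfMerged βm 0⃗`, the `limUnder` along the zero edge — CRIT-2 g3 (P2)).  The corner edition of K2⁷'s XL stub (1ᶜᴿ `RunChain190AtCornerDriftSlope`)
asks for run rows relative to an ANCHORED in-box corner sequence `b` (`ScaleAnchor D.βfun b`).  So:
* §1 the SPLIT-FREE, `b`-PARAMETRIC leaf socket (p603015 §2's `hbox`∕`hrun` shapes) serves 1ᶜᴿ's ∃-block at ANY `b` with no coincidence (`cornerRunRowsBody_of_boxLeaves190H`,
  `…_of_runLeaves190H`): NODE O types its (190)-chain relative to the corner `b` directly;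
* §2 the split-keyed socket of record serves it MODULO the displayed coincidence `∀ k, D.βfun k 0⃗ = b k` («fill = corner»; `cornerRunRows_of_chainTFac190H_fillEq`,
  `cornerRunRowsBody_of_chainTFac190H_fillEq`) — content: [I] (2.13)-type history-independence of the `g → 0⁺` face + the definer's off-box convention; `rfl`-grade at no record of record;
* §3 the coincidence in corner currency: «fill = corner» ⟺ «the fill is itself a corner anchor» given any anchor (`fill_eq_of_scaleAnchor_fill`, `scaleAnchor_fill_of_fill_eq`; `ScaleAnchor.eq`).

HONEST FRAMING.  Implications between displayed HYPOTHESIS SHAPES; NOTHING of Bałaban's analysis is asserted or discharged; the leaves, the chain structure, the anchor, the coincidence,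
(C) are hypotheses inhabited at no tuple here (instance 0∕1); (D4) NOT discharged; K2⁷ and its stubs NOT proved (v7c 795c9e8285fed415 = the registered skeleton of 20543, texts byte-identical to the draft
39189bf31904f7f3; 20543 is `aside` since route rev 27 — its stubs are supplier roads of K1⁸ stmt-QuantumFields-26907's rows conjunct); counts unmoved; [Balaban1987RG1] Thm 2 + (0.31) p. 259 is UNPROVED IN PRINT; route R4 closes the CONDITIONAL finite-𝕋⁴ rung `BalabanLadder.UV` only — NOT the
continuum limit, NOT ℝ⁴, NOT OS, NOT the Yang–Mills mass gap, NOT Clay.  No `def`, no `instance`, no `notation`, no `axiom`.  Sources (context only): [I] = [Balaban1987RG1] CMP **109**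
(1987): Thm 3 p. 264, (1.20)–(1.22) p. 264, (2.12)–(2.14) p. 268, (4.4) p. 281, (5.10) p. 293; [II] = [Balaban1988RG2Cluster] CMP **116** (1988): Lemma 3 (2.38) p. 20.
-/

noncomputable section

namespace Summit.QuantumFields.YangMills.Theorems.BalabanUVNodesK2CornerSocket

open Literature.MathematicalPhysics.QuantumFieldTheory.Balaban1983to89
open Literature.MathematicalPhysics.QuantumFieldTheory.Balaban1983to89.FlowStep
open Literature.MathematicalPhysics.QuantumFieldTheory.Balaban1983to89.B12Beta (HistBox OneLoopSplit)
open Literature.MathematicalPhysics.QuantumFieldTheory.Balaban1983to89.B13ScaleTransfer (Pt)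
open Literature.MathematicalPhysics.QuantumFieldTheory.Balaban1983to89.T4Continuum (T4Family)
open Literature.MathematicalPhysics.QuantumFieldTheory.Balaban1983to89.Beta.RemainderChainLattice
open Literature.MathematicalPhysics.QuantumFieldTheory.Balaban1983to89.Beta.RemainderLimitTorus (LDom limKernel)
open Literature.MathematicalPhysics.QuantumFieldTheory.Balaban1983to89.Beta.RemainderLocalityHolo
open Literature.MathematicalPhysics.QuantumFieldTheory.Balaban1983to89.Beta.RemainderDecay190
open Literature.MathematicalPhysics.QuantumFieldTheory.Balaban1983to89.Beta.RemainderDecay190HoloChain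
open Summit.QuantumFields.BalabanUV.Gaps.BetaContFromD4Chain (CPt betaContH_of_chainTFac190H)
open Summit.QuantumFields.YangMills.Theorems.BalabanUVNodesK2NamedJetsRemAt (ScaleAnchor)
open Summit.QuantumFields.YangMills.Theorems.BalabanUVNodesK2NamedJetsRunRemAt (SurvCont SurvCont.of_betaContH)
open Summit.QuantumFields.YangMills.Theorems.BalabanUVNodesK2RunRemAtOfChain190 (runLeaves190H_of_boxLeaves190H)
open Summit.QuantumFields.YangMills.Theorems.BalabanUVNodesK2OwnDriftPair (ownRunRows_of_chainTFac190H)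

variable (F : T4Family) (θ : Node00.Stage13HParams F 2) (hP : θ.Provisos₁₃SepCoPH F 2)
variable {M : ℕ} [NeZero M] {μ ν : Fin 4} {b : ℕ → ℝ} {c : B13.Consts} {ℓ α₂ : ℝ} {q : Consts190} {γ₀ s : ℝ}

/-! ## §1 The split-free, `b`-parametric leaf socket serves 1ᶜᴿ's body at ANY `b` -/

/-- **THE `b`-PARAMETRIC LEAF SOCKET ⟹ 1ᶜᴿ's ∃-BLOCK AT `b`**: the (190)-leaves relative to `b` on the WHOLE box `]0, γ₀]^{k+1}` (p603015's `hbox` shape), the [II] side conditions,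
`0 < γ₀`, the cap against the slope and (C) on the box ⟹ the ∃-block of v7c's `RunChain190AtCornerDriftSlope` at that `b` VERBATIM (run rows by `runLeaves190H_of_boxLeaves190H`; survivor
(C) from box (C)).  No split, no fill, no coincidence: what NODE O owes for 1ᶜᴿ on print's road if it types its chain relative to the corner `b` directly.  CONDITIONAL; instance 0∕1.
[cite: Balaban1987RG1, (1.20)-(1.22) p.264, (4.4) p.281 and (5.10) p.293; Balaban1988RG2Cluster, Lemma 3 (2.38) p.20] -/
theorem cornerRunRowsBody_of_boxLeaves190H
    (hbox : ∀ (k : ℕ) (p : Fin (k + 1) → ℝ), p ∈ HistBox γ₀ k →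
      ∃ a : LDom 4 → Pt 4 → ℝ, (Node00.datumOfRecord₁₃SepCoPH F 2 θ hP).βfun k p - b k =
        B12Beta.secondMoment (fun _ _ => limKernel a) μ ν ∧ Nonempty (PolLeavesTFac190H 4 M a c ℓ α₂ q))
    (hC : CondsL 4 c ℓ) (h22 : c.R22gen ℓ) (hq : q.Valid c.δ₀) (hs : SignsL c α₂ q.B₃) (hγ₀ : 0 < γ₀)
    (hcap : c.ε₁ * remCoeffL 4 M c α₂ q.B₃ ≤ s) (hcont : BetaContH γ₀ (Node00.datumOfRecord₁₃SepCoPH F 2 θ hP).βfun) :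
    ∃ (M : ℕ) (_ : NeZero M) (μ ν : Fin 4) (c : B13.Consts) (ℓ α₂ : ℝ) (q : Consts190) (γ₀ : ℝ),
      (∀ (n : ℕ) (gs : ℕ → ℝ), RGEqH n (Node00.datumOfRecord₁₃SepCoPH F 2 θ hP).βfun gs → Step.InInterval γ₀ n gs → ∀ k, k ≤ n →
        ∃ a : LDom 4 → Pt 4 → ℝ, (Node00.datumOfRecord₁₃SepCoPH F 2 θ hP).βfun k (prefixOf gs k) - b k =
          B12Beta.secondMoment (fun _ _ => limKernel a) μ ν ∧ Nonempty (PolLeavesTFac190H 4 M a c ℓ α₂ q)) ∧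
      CondsL 4 c ℓ ∧ c.R22gen ℓ ∧ q.Valid c.δ₀ ∧ SignsL c α₂ q.B₃ ∧ 0 < γ₀ ∧
      c.ε₁ * remCoeffL 4 M c α₂ q.B₃ ≤ s ∧ SurvCont (Node00.datumOfRecord₁₃SepCoPH F 2 θ hP).βfun γ₀ :=
  ⟨M, inferInstance, μ, ν, c, ℓ, α₂, q, γ₀, runLeaves190H_of_boxLeaves190H hbox, hC, h22, hq, hs, hγ₀, hcap, SurvCont.of_betaContH hγ₀ hcont⟩

/-- **RUN edition**: the leaves relative to `b` only at the in-window run prefixes (p603015's `hrun` shape; BN-F (N3)-compliant) + side conditions + cap + survivor (C) ⟹ the same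
∃-block.  [folklore] -/
theorem cornerRunRowsBody_of_runLeaves190H
    (hrun : ∀ (n : ℕ) (gs : ℕ → ℝ), RGEqH n (Node00.datumOfRecord₁₃SepCoPH F 2 θ hP).βfun gs → Step.InInterval γ₀ n gs → ∀ k, k ≤ n →
      ∃ a : LDom 4 → Pt 4 → ℝ, (Node00.datumOfRecord₁₃SepCoPH F 2 θ hP).βfun k (prefixOf gs k) - b k =
        B12Beta.secondMoment (fun _ _ => limKernel a) μ ν ∧ Nonempty (PolLeavesTFac190H 4 M a c ℓ α₂ q))
    (hC : CondsL 4 c ℓ) (h22 : c.R22gen ℓ) (hq : q.Valid c.δ₀) (hs : SignsL c α₂ q.B₃) (hγ₀ : 0 < γ₀)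
    (hcap : c.ε₁ * remCoeffL 4 M c α₂ q.B₃ ≤ s) (hcont : SurvCont (Node00.datumOfRecord₁₃SepCoPH F 2 θ hP).βfun γ₀) :
    ∃ (M : ℕ) (_ : NeZero M) (μ ν : Fin 4) (c : B13.Consts) (ℓ α₂ : ℝ) (q : Consts190) (γ₀ : ℝ),
      (∀ (n : ℕ) (gs : ℕ → ℝ), RGEqH n (Node00.datumOfRecord₁₃SepCoPH F 2 θ hP).βfun gs → Step.InInterval γ₀ n gs → ∀ k, k ≤ n →
        ∃ a : LDom 4 → Pt 4 → ℝ, (Node00.datumOfRecord₁₃SepCoPH F 2 θ hP).βfun k (prefixOf gs k) - b k =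
          B12Beta.secondMoment (fun _ _ => limKernel a) μ ν ∧ Nonempty (PolLeavesTFac190H 4 M a c ℓ α₂ q)) ∧
      CondsL 4 c ℓ ∧ c.R22gen ℓ ∧ q.Valid c.δ₀ ∧ SignsL c α₂ q.B₃ ∧ 0 < γ₀ ∧
      c.ε₁ * remCoeffL 4 M c α₂ q.B₃ ≤ s ∧ SurvCont (Node00.datumOfRecord₁₃SepCoPH F 2 θ hP).βfun γ₀ :=
  ⟨M, inferInstance, μ, ν, c, ℓ, α₂, q, γ₀, hrun, hC, h22, hq, hs, hγ₀, hcap, hcont⟩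

/-! ## §2 The split-keyed socket of record serves it MODULO «fill = corner» -/

/-- **SPLIT-KEYED SOCKET + «fill = corner» ⟹ RUN ROWS AT `b`**: a `ChainTFac190H` inhabitant for ANY split of the datum's β gives run rows relative to the FILL `k ↦ D.βfun k 0⃗`
(`ownRunRows_of_chainTFac190H`, p609486 §3); the displayed coincidence `∀ k, D.βfun k 0⃗ = b k` re-targets them to `b`.  The coincidence is CONTENT ([I] (2.13) history-independence of
the face + the definer's off-box convention), `rfl`-grade at no record of record (`v₀ := 0⃗`).  CONDITIONAL. [cite: Balaban1987RG1, (2.12)-(2.14) p.268 and (5.10) p.293; Balaban1988RG2Cluster, Lemma 3 (2.38) p.20] -/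
theorem cornerRunRows_of_chainTFac190H_fillEq (Sβ : OneLoopSplit (Node00.datumOfRecord₁₃SepCoPH F 2 θ hP).βfun)
    (R : ChainTFac190H 4 M μ ν Sβ γ₀ c ℓ α₂ q) (hfill : ∀ k, (Node00.datumOfRecord₁₃SepCoPH F 2 θ hP).βfun k (fun _ => 0) = b k) :
    ∀ (n : ℕ) (gs : ℕ → ℝ), RGEqH n (Node00.datumOfRecord₁₃SepCoPH F 2 θ hP).βfun gs → Step.InInterval γ₀ n gs → ∀ k, k ≤ n →
      ∃ a : LDom 4 → Pt 4 → ℝ, (Node00.datumOfRecord₁₃SepCoPH F 2 θ hP).βfun k (prefixOf gs k) - b k =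
        B12Beta.secondMoment (fun _ _ => limKernel a) μ ν ∧ Nonempty (PolLeavesTFac190H 4 M a c ℓ α₂ q) := fun n gs hrg hI k hk => by
  obtain ⟨a, ha, hL⟩ := ownRunRows_of_chainTFac190H F θ hP Sβ R n gs hrg hI k hk
  exact ⟨a, by rw [← hfill k]; exact ha, hL⟩

/-- **★ SPLIT-KEYED SOCKET OF RECORD + (C-pt) + CAP + «fill = corner» ⟹ 1ᶜᴿ's ∃-BLOCK AT `b`** (p609486 §3 `ownRunRowsBody_of_chainTFac190H` re-targeted): what the row's socket
of record delivers for the corner stub, with the coincidence DISPLAYED as the extra input dag-n18-w1 ∕ DEF-1 (ii) ∕ an4 (K′) located.  CONDITIONAL; instance 0∕1.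
[cite: Balaban1987RG1, (1.20)-(1.22) p.264, (4.4) p.281 and (5.10) p.293; Balaban1988RG2Cluster, Lemma 3 (2.38) p.20] -/
theorem cornerRunRowsBody_of_chainTFac190H_fillEq (Sβ : OneLoopSplit (Node00.datumOfRecord₁₃SepCoPH F 2 θ hP).βfun)
    (R : ChainTFac190H 4 M μ ν Sβ γ₀ c ℓ α₂ q) (hcpt : CPt R) (hC : CondsL 4 c ℓ) (h22 : c.R22gen ℓ) (hq : q.Valid c.δ₀)
    (hs : SignsL c α₂ q.B₃) (hγ₀ : 0 < γ₀) (hcap : c.ε₁ * remCoeffL 4 M c α₂ q.B₃ ≤ s)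
    (hfill : ∀ k, (Node00.datumOfRecord₁₃SepCoPH F 2 θ hP).βfun k (fun _ => 0) = b k) :
    ∃ (M : ℕ) (_ : NeZero M) (μ ν : Fin 4) (c : B13.Consts) (ℓ α₂ : ℝ) (q : Consts190) (γ₀ : ℝ),
      (∀ (n : ℕ) (gs : ℕ → ℝ), RGEqH n (Node00.datumOfRecord₁₃SepCoPH F 2 θ hP).βfun gs → Step.InInterval γ₀ n gs → ∀ k, k ≤ n →
        ∃ a : LDom 4 → Pt 4 → ℝ, (Node00.datumOfRecord₁₃SepCoPH F 2 θ hP).βfun k (prefixOf gs k) - b k =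
          B12Beta.secondMoment (fun _ _ => limKernel a) μ ν ∧ Nonempty (PolLeavesTFac190H 4 M a c ℓ α₂ q)) ∧
      CondsL 4 c ℓ ∧ c.R22gen ℓ ∧ q.Valid c.δ₀ ∧ SignsL c α₂ q.B₃ ∧ 0 < γ₀ ∧
      c.ε₁ * remCoeffL 4 M c α₂ q.B₃ ≤ s ∧ SurvCont (Node00.datumOfRecord₁₃SepCoPH F 2 θ hP).βfun γ₀ :=
  ⟨M, inferInstance, μ, ν, c, ℓ, α₂, q, γ₀, cornerRunRows_of_chainTFac190H_fillEq F θ hP Sβ R hfill, hC, h22, hq, hs, hγ₀, hcap,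
    SurvCont.of_betaContH hγ₀ (betaContH_of_chainTFac190H R hC h22 hq hs (by norm_num) hcpt)⟩

/-! ## §3 The coincidence in corner currency -/

/-- «fill = corner» FROM a corner anchor OF THE FILL: if the fill sequence `k ↦ D.βfun k 0⃗` is itself an in-box corner limit of the datum's β, it IS the anchored `b` (`ScaleAnchor.eq`).
So the coincidence is exactly «the definer's off-box value is the in-box corner limit» — [I] (2.13) «vanishes at g_k = 0» read as a LIMIT statement at the datum. [cite: Balaban1987RG1, (2.12)-(2.14) p.268] -/
theorem fill_eq_of_scaleAnchor_fill
    (hfillA : ScaleAnchor (Node00.datumOfRecord₁₃SepCoPH F 2 θ hP).βfun fun k => (Node00.datumOfRecord₁₃SepCoPH F 2 θ hP).βfun k (fun _ => 0))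
    (hb : ScaleAnchor (Node00.datumOfRecord₁₃SepCoPH F 2 θ hP).βfun b) :
    ∀ k, (Node00.datumOfRecord₁₃SepCoPH F 2 θ hP).βfun k (fun _ => 0) = b k :=
  fun k => congrFun (hfillA.eq hb) k

/-- Conversely, under «fill = corner» the fill inherits the anchor. [folklore] -/
theorem scaleAnchor_fill_of_fill_eq (hb : ScaleAnchor (Node00.datumOfRecord₁₃SepCoPH F 2 θ hP).βfun b)
    (hfill : ∀ k, (Node00.datumOfRecord₁₃SepCoPH F 2 θ hP).βfun k (fun _ => 0) = b k) :
    ScaleAnchor (Node00.datumOfRecord₁₃SepCoPH F 2 θ hP).βfun fun k => (Node00.datumOfRecord₁₃SepCoPH F 2 θ hP).βfun k (fun _ => 0) := by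
  have h : (fun k => (Node00.datumOfRecord₁₃SepCoPH F 2 θ hP).βfun k (fun _ => 0)) = b := funext hfill
  rw [h]; exact hb

/-- **THE SOCKET OF RECORD AT THE CORNER, COINCIDENCE DISCHARGED BY A FILL ANCHOR**: split-keyed chain + (C-pt) + cap + «the fill is a corner anchor» ⟹ 1ᶜᴿ's ∃-block at every anchored
`b` (the `∀ b, ScaleAnchor … b →` of the registered text is then met by `ScaleAnchor.eq`).  CONDITIONAL; instance 0∕1. [cite: Balaban1987RG1, (2.12)-(2.14) p.268 and (5.10) p.293; Balaban1988RG2Cluster, Lemma 3 (2.38) p.20] -/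
theorem cornerRunRowsBody_of_chainTFac190H_fillAnchor (Sβ : OneLoopSplit (Node00.datumOfRecord₁₃SepCoPH F 2 θ hP).βfun)
    (R : ChainTFac190H 4 M μ ν Sβ γ₀ c ℓ α₂ q) (hcpt : CPt R) (hC : CondsL 4 c ℓ) (h22 : c.R22gen ℓ) (hq : q.Valid c.δ₀)
    (hs : SignsL c α₂ q.B₃) (hγ₀ : 0 < γ₀) (hcap : c.ε₁ * remCoeffL 4 M c α₂ q.B₃ ≤ s)
    (hfillA : ScaleAnchor (Node00.datumOfRecord₁₃SepCoPH F 2 θ hP).βfun fun k => (Node00.datumOfRecord₁₃SepCoPH F 2 θ hP).βfun k (fun _ => 0))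
    (hb : ScaleAnchor (Node00.datumOfRecord₁₃SepCoPH F 2 θ hP).βfun b) :
    ∃ (M : ℕ) (_ : NeZero M) (μ ν : Fin 4) (c : B13.Consts) (ℓ α₂ : ℝ) (q : Consts190) (γ₀ : ℝ),
      (∀ (n : ℕ) (gs : ℕ → ℝ), RGEqH n (Node00.datumOfRecord₁₃SepCoPH F 2 θ hP).βfun gs → Step.InInterval γ₀ n gs → ∀ k, k ≤ n →
        ∃ a : LDom 4 → Pt 4 → ℝ, (Node00.datumOfRecord₁₃SepCoPH F 2 θ hP).βfun k (prefixOf gs k) - b k =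
          B12Beta.secondMoment (fun _ _ => limKernel a) μ ν ∧ Nonempty (PolLeavesTFac190H 4 M a c ℓ α₂ q)) ∧
      CondsL 4 c ℓ ∧ c.R22gen ℓ ∧ q.Valid c.δ₀ ∧ SignsL c α₂ q.B₃ ∧ 0 < γ₀ ∧
      c.ε₁ * remCoeffL 4 M c α₂ q.B₃ ≤ s ∧ SurvCont (Node00.datumOfRecord₁₃SepCoPH F 2 θ hP).βfun γ₀ :=
  cornerRunRowsBody_of_chainTFac190H_fillEq F θ hP Sβ R hcpt hC h22 hq hs hγ₀ hcap (fill_eq_of_scaleAnchor_fill F θ hP hfillA hb)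

end Summit.QuantumFields.YangMills.Theorems.BalabanUVNodesK2CornerSocket

end
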